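import Summits.BirchSwinnertonDyer.BirchSwinnertonDyer.Theorems.SignedLowerHalvesRibetBadEulerFactorNewformCoefficients
import Summits.BirchSwinnertonDyer.BirchSwinnertonDyer.Theorems.SignedLowerHalvesRibetBadEulerFactorAvatar
import Literature.NumberTheory.EllipticCurves.CMNewformGamma0BadEulerFactorsPadicCharacter
import HarnessLib

/-!
# Route `SignedLowerHalves`, crux L `SmallImageLowerHalfBothSigns` (stmt-BirchSwinnertonDyer-23599), line `rtt_w3`: DE-CITE of the Ribet (BAD)
# conjunct, FILE 3 of 3 — ★★ `Ribet1977_cmNewform_gamma0_badEulerFactor_padicCharacter` FROM Shimura's newness of the primitive theta series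
# (INPUTS seat `bsd-inputs-honda-p1` g33; THEOREMS ONLY)

WHAT.  ★★ `ribet1977_cmNewform_gamma0_badEulerFactor_padicCharacter_of_shimura`:
`shimura1972_heckeTheta_isNewform0_of_primitive → Ribet1977_cmNewform_gamma0_badEulerFactor_padicCharacter` — the bespoke residual cite of
`stub_citedInputs_rtt` (the Euler factors of the `Γ₀` CM newform `g` at the primes `ℓ ∣ |d_K|·N𝔪`, through the `p`-adic avatar `θ`) is DERIVED from the
textbook statement «the theta series of a primitive Größencharakter is a newform of level `|d_K|·N𝔣`» (Shimura; Ribet 1977 Remark (3.5); Miyake 4.8.2;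
Literature fact `shimura1972_heckeTheta_isNewform0_of_primitive`, honda g33 p832644).  Count-neutral swap for the LEAD's next re-key: cite Shimura,
derive Ribet (BAD) by this theorem.

PROOF (files 1–2 supply the two inputs).  With the primitive companion `(𝔠, ψ₀)` of `(𝔪, ψ)`: (file 1, `exists_primitive_embCoeff_eq`) `M = |d_K|·N𝔠`
and `ι(a_n(g)) = e⁻¹(Σ_{N𝔞 = n, (𝔞,𝔠)=1} ψ̃₀(𝔞))` for all `n ≥ 1`; (file 2, `isUnramifiedAt_iff_and_entry_eq_of_pinned`) for `w ∌ p`: `θ` unramified at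
`w` iff `w ∤ 𝔠`, and then `θ(Frob_w)₀₀ = e⁻¹ψ₀(w)`.  So `Tℓ = {w ∣ ℓ : w ∤ 𝔠}` and, by the decomposition of `ℓ` in `K`
(`placesOver_trichotomy_of_finrank_eq_two`) with the Kronecker character `κ` (`ψ₀((ℓ)) = κ(ℓ)·ℓ` for `ℓ ∤ |d_K|·N𝔠`; `κ(ℓ) = ±1` detects `ℓ ∤ d_K`):
SPLIT `ℓ = w₁w₂`: both prime to `𝔠`: `(1 − ψ₀(w₁)X)(1 − ψ₀(w₂)X) = 1 − (ψ₀(w₁)+ψ₀(w₂))X + ℓX²`, `ℓ ∤ M`; exactly one, say `w₂ ∤ 𝔠`: `1 − ψ₀(w₂)X` both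
sides, `ℓ ∣ M`; none: `1 = 1`.  INERT `(ℓ) = w₀`: `w₀ ∤ 𝔠`: no ideal of norm `ℓ`, `ℓ ∤ M`, `1 + ℓX² = 1 − ψ₀(w₀)X²` (`ψ₀((ℓ)) = −ℓ`); `w₀ ∣ 𝔠`: `1 = 1`.
RAMIFIED `(ℓ) = w₀²` (`ℓ ∣ d_K ∣ M`): `1 − ψ₀(w₀)X` both sides, or `1 = 1`.

HONEST SCOPE: count-NEUTRAL hygiene (director-bsd (918)(b)/(922)(i)); the theorem is CONDITIONAL on the Shimura fact (a cite, no `_holds`);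
nothing here closes a stub; crux L is a kernel theorem only modulo its cited print facts and crux M; BSD is proved for NO curve.

References: [Ribet1977Nebentypus] §3 Thm. (3.4), Cor. (3.5), Remark (3.5); [Shimura1972ClassFieldsRealQuadratic] p. 138; [Miyake2006] Thm. 4.6.17,
Thm. 4.8.2; [NeukirchANT1999] I (8.2)–(8.3), VII §6 (6.14); [Cox2013] §1.C Lemma 1.14; [SerreAbelianLadic1968] Ch. I §2.3.
-/

set_option linter.dupNamespace false
set_option autoImplicit false

noncomputable section

open scoped NumberField ModularForm MatrixGroups
open NumberField IsDedekindDomain CongruenceSubgroup Polynomial Rat.HeightOneSpectrum Filter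
open Literature.NumberTheory.GaloisRepresentations Literature.NumberTheory.LFunctions
  Literature.NumberTheory.Automorphic Literature.NumberTheory.EllipticCurves Literature.NumberTheory.EllipticCurves.ModularForms

namespace Summit.BirchSwinnertonDyer.BirchSwinnertonDyer.Theorems.RibetBadEulerFactor

/-! ## §1 Norm bookkeeping -/

section Norms

variable {K : Type} [Field K] [NumberField K]

/-- A rational prime dividing `N I` (`I ≠ 0`) divides `N𝔭` for some prime `𝔭 ⊇ I` (multiplicativity of the norm over the prime factorisation).
[cite: NeukirchANT1999, Ch. I §3 (3.3) and (8.2)] -/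
private theorem exists_prime_le_of_prime_dvd_absNorm {I : Ideal (𝓞 K)} (hI : I ≠ ⊥) {ℓ : ℕ} (hℓ : ℓ.Prime)
    (h : ℓ ∣ Ideal.absNorm I) : ∃ w : HeightOneSpectrum (𝓞 K), I ≤ w.asIdeal ∧ ℓ ∣ Ideal.absNorm w.asIdeal := by
  have hN : Ideal.absNorm I = ((UniqueFactorizationMonoid.normalizedFactors I).map Ideal.absNorm).prod := by
    rw [← map_multiset_prod, Ideal.prod_normalizedFactors_eq_self hI]
  rw [hN] at h
  obtain ⟨P, hP, hℓP⟩ := Prime.exists_mem_multiset_map_dvd (Nat.prime_iff.mp hℓ)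
    (s := UniqueFactorizationMonoid.normalizedFactors I) (f := fun P => Ideal.absNorm P) h
  have hPp : Prime P := UniqueFactorizationMonoid.prime_of_normalized_factor P hP
  exact ⟨⟨P, Ideal.isPrime_of_prime hPp, hPp.ne_zero⟩, Ideal.le_of_dvd (UniqueFactorizationMonoid.dvd_of_mem_normalizedFactors hP), hℓP⟩

/-- A prime `𝔭` with `ℓ ∣ N𝔭` contains `ℓ` (`N𝔭` is a power of the residue characteristic). [cite: NeukirchANT1999, Ch. I (8.2)] -/
private theorem natCast_mem_of_dvd_absNorm {ℓ : ℕ} (hℓ : ℓ.Prime) (v : HeightOneSpectrum (𝓞 K))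
    (h : ℓ ∣ Ideal.absNorm v.asIdeal) : (ℓ : 𝓞 K) ∈ v.asIdeal := by
  haveI := v.isMaximal
  haveI : Finite (𝓞 K ⧸ v.asIdeal) := Ideal.finiteQuotientOfFreeOfNeBot v.asIdeal v.ne_bot
  letI : Field (𝓞 K ⧸ v.asIdeal) := Ideal.Quotient.field v.asIdeal
  obtain ⟨q, hqchar⟩ := CharP.exists (𝓞 K ⧸ v.asIdeal)
  have hq : q.Prime := CharP.char_is_prime (𝓞 K ⧸ v.asIdeal) q
  have hqv : (q : 𝓞 K) ∈ v.asIdeal := by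
    rw [← Ideal.Quotient.eq_zero_iff_mem, map_natCast]
    exact CharP.cast_eq_zero (𝓞 K ⧸ v.asIdeal) q
  have hqZ : Prime (q : ℤ) := Nat.prime_iff_prime_int.mp hq
  have hunder : v.asIdeal.under ℤ = Ideal.span {(q : ℤ)} := by
    haveI hmax : (Ideal.span {(q : ℤ)}).IsMaximal :=
      ((Ideal.span_singleton_prime hqZ.ne_zero).mpr hqZ).isMaximal (by simpa using hqZ.ne_zero)
    refine (hmax.eq_of_le (Ideal.IsPrime.under ℤ v.asIdeal).ne_top ?_).symm
    rw [Ideal.span_singleton_le_iff_mem, Ideal.under_def, Ideal.mem_comap, map_natCast]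
    exact hqv
  haveI : v.asIdeal.LiesOver (Ideal.span {(q : ℤ)}) := ⟨hunder.symm⟩
  have hnorm := Ideal.absNorm_eq_pow_inertiaDeg' v.asIdeal hq
  rw [hnorm] at h
  have hℓq : ℓ = q := (Nat.prime_dvd_prime_iff_eq hℓ hq).mp (hℓ.dvd_of_dvd_pow h)
  subst hℓq
  exact hqv

/-- **`ℓ ∣ N𝔠` iff some prime of `𝔠` lies over `ℓ`.** [cite: NeukirchANT1999, Ch. I (8.2)] -/
theorem dvd_absNorm_iff_exists_le (v : HeightOneSpectrum (𝓞 ℚ)) {𝔠 : Ideal (𝓞 K)} (h𝔠 : 𝔠 ≠ ⊥) :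
    natGenerator v ∣ Ideal.absNorm 𝔠 ↔ ∃ w : HeightOneSpectrum (𝓞 K), w.under (𝓞 ℚ) = v ∧ 𝔠 ≤ w.asIdeal := by
  constructor
  · intro h
    obtain ⟨w, hle, hℓw⟩ := exists_prime_le_of_prime_dvd_absNorm h𝔠 (prime_natGenerator v) h
    refine ⟨w, ?_, hle⟩
    rw [under_eq_iff_natCast_primesEquiv_mem]
    exact natCast_mem_of_dvd_absNorm (prime_natGenerator v) w hℓw
  · rintro ⟨w, hw, hle⟩
    have h1 : Ideal.absNorm w.asIdeal ∣ Ideal.absNorm 𝔠 := Ideal.absNorm_dvd_absNorm_of_le hle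
    rw [absNorm_asIdeal_eq_natGenerator_pow, hw] at h1
    haveI : w.asIdeal.IsPrime := w.isPrime
    exact (dvd_pow_self _ (Ideal.inertiaDeg_pos (R := 𝓞 ℚ) (q := w.asIdeal)).ne').trans h1

/-- `rayClassCoeff 𝔠 ψ 𝔭_w = 0` at a prime of `𝔠` (`𝔭_w` is not prime to `𝔠`). [cite: NeukirchANT1999, Ch. VII §8 (first paragraph)] -/
theorem rayClassCoeff_asIdeal_of_le (𝔠 : Ideal (𝓞 K)) (ψ : HeightOneSpectrum (𝓞 K) → ℂ) {w : HeightOneSpectrum (𝓞 K)} (hw : 𝔠 ≤ w.asIdeal) :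
    rayClassCoeff 𝔠 ψ w.asIdeal = 0 := by
  classical
  have hnc : ¬ IsCoprime w.asIdeal 𝔠 := fun h => by
    rw [Ideal.isCoprime_iff_sup_eq, sup_eq_left.mpr hw] at h
    exact w.isPrime.ne_top h
  simp [rayClassCoeff, hnc]

/-- `rayClassCoeff 𝔠 ψ 𝔭_w = ψ w` at a prime NOT dividing `𝔠`. [cite: NeukirchANT1999, Ch. VII §8 (first paragraph)] -/
theorem rayClassCoeff_asIdeal_of_not_le (𝔠 : Ideal (𝓞 K)) (ψ : HeightOneSpectrum (𝓞 K) → ℂ) {w : HeightOneSpectrum (𝓞 K)}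
    (hw : ¬ 𝔠 ≤ w.asIdeal) : rayClassCoeff 𝔠 ψ w.asIdeal = ψ w := by
  have hcop : IsCoprime w.asIdeal 𝔠 := by
    rw [Ideal.isCoprime_iff_sup_eq]
    by_contra hne
    rcases w.isMaximal.eq_of_le (J := w.asIdeal ⊔ 𝔠) (fun h => hne h) le_sup_left with h
    exact hw (h ▸ le_sup_right)
  exact rayClassCoeff_asIdeal_of_isCoprime _ _ hcop

/-- The ideals of norm `ℓ` when `ℓ` is ramified, `(ℓ) = 𝔭_w²`: only `𝔭_w`. [cite: NeukirchANT1999, Ch. I (8.2)–(8.3)] -/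
theorem setOf_absNorm_eq_of_ramified (v : HeightOneSpectrum (𝓞 ℚ)) {w₀ : HeightOneSpectrum (𝓞 K)}
    (hS : {w : HeightOneSpectrum (𝓞 K) | w.under (𝓞 ℚ) = v} = {w₀}) (hf : w₀.asIdeal.inertiaDeg (𝓞 ℚ) = 1) :
    {I : Ideal (𝓞 K) | Ideal.absNorm I = natGenerator v} = {w₀.asIdeal} := by
  ext I
  simp only [Set.mem_setOf_eq, Set.mem_singleton_iff]
  rw [absNorm_eq_natGenerator_iff]
  have hwv : ∀ {w : HeightOneSpectrum (𝓞 K)}, w.asIdeal.under (𝓞 ℚ) = v.asIdeal ↔ w.under (𝓞 ℚ) = v := fun {w} => by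
    rw [HeightOneSpectrum.ext_iff, HeightOneSpectrum.under_asIdeal]
  constructor
  · rintro ⟨w, rfl, hunder, -⟩
    have hw : w ∈ ({w₀} : Set (HeightOneSpectrum (𝓞 K))) := by rw [← hS]; exact hwv.mp hunder
    rw [Set.mem_singleton_iff] at hw
    rw [hw]
  · intro hI
    have hw₀ : w₀ ∈ {w : HeightOneSpectrum (𝓞 K) | w.under (𝓞 ℚ) = v} := by rw [hS]; exact Set.mem_singleton _
    exact ⟨w₀, hI.symm, hwv.mpr hw₀, hf⟩

end Norms

/-! ## §2 ★★ The (BAD) Euler factors from Shimura's newness -/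

section Main

/-- ★★ **Ribet's bad Euler factors through the `p`-adic character, FROM Shimura's newness of the primitive theta series**:
`shimura1972_heckeTheta_isNewform0_of_primitive → Ribet1977_cmNewform_gamma0_badEulerFactor_padicCharacter`.  For every prime
`ℓ ∣ |d_K|·N𝔪`, `ℓ ≠ p`: `1 − C(ι a_ℓ(g))X + 𝟙_{ℓ∤M} C(ℓ)X² = ∏_{w ∋ ℓ, θ unramified at w} (1 − C(θ(φ_w)₀₀) X^{f w})`, where — by files 1–2 — `g` is the
theta series of the primitive companion `(𝔠, ψ₀)`, `M = |d_K|·N𝔠`, the unramified `w ∣ ℓ` are those prime to `𝔠`, and `θ(φ_w)₀₀ = e⁻¹ψ₀(w)` there;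
the identity is then the decomposition law of `ℓ` in `K` with `ψ₀(𝔭)ψ₀(𝔭̄) = ℓ` (split), `ψ₀((ℓ)) = −ℓ` (inert).  See the module docstring for the cases.
[cite: Ribet1977Nebentypus, §3 Cor. (3.5) and Remark (3.5) (LNM 601, p. 35)] [cite: Miyake2006, Thm. 4.6.17 and Thm. 4.8.2]
[cite: NeukirchANT1999, Ch. I (8.2)–(8.3)] [cite: Cox2013, §1.C Lemma 1.14] -/
theorem ribet1977_cmNewform_gamma0_badEulerFactor_padicCharacter_of_shimura (hSh : shimura1972_heckeTheta_isNewform0_of_primitive) :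
    Ribet1977_cmNewform_gamma0_badEulerFactor_padicCharacter := by
  intro K _ _ hK2 htc σK 𝔪 h𝔪 ψ hψ hψpow p _ e M _ g ι hng hcoeffψ S θ hθ ℓ hℓ hℓp hℓD Tℓ φ f hT hφ hf
  classical
  haveI := htc
  -- file 1: the primitive companion and ALL coefficients of `g`
  obtain ⟨𝔠, ψ₀, h𝔠, hle, hψ₀, heq, hne0, hsharp, hneb₀, hM, hcoef⟩ :=
    exists_primitive_embCoeff_eq hSh hK2 htc σK h𝔪 hψ hψpow e ι hng hcoeffψ
  subst hM
  -- the rational place `v` under `ℓ`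
  obtain ⟨v, hv⟩ : ∃ v : HeightOneSpectrum (𝓞 ℚ), (primesEquiv v : ℕ) = ℓ := ⟨primesEquiv.symm ⟨ℓ, hℓ⟩, by rw [Equiv.apply_symm_apply]⟩
  subst hv
  have hℓv : ((primesEquiv v : ℕ)) = natGenerator v := rfl
  rw [hℓv] at hℓp hℓD hT hf ⊢
  have hover : ∀ w : HeightOneSpectrum (𝓞 K), ((natGenerator v : ℕ) : 𝓞 K) ∈ w.asIdeal ↔ w.under (𝓞 ℚ) = v :=
    fun w ↦ (under_eq_iff_natCast_primesEquiv_mem w v).symm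
  have hwp : ∀ w : HeightOneSpectrum (𝓞 K), w.under (𝓞 ℚ) = v → ((p : ℕ) : 𝓞 K) ∉ w.asIdeal :=
    fun w hw ↦ natCast_not_mem_asIdeal_of_natCast_mem hℓ Fact.out hℓp ((hover w).mpr hw)
  -- file 2: `Tℓ = {w ∣ ℓ : w ∤ 𝔠}` and the Frobenius values
  have havatar := fun w (hw : w.under (𝓞 ℚ) = v) ↦
    isUnramifiedAt_iff_and_entry_eq_of_pinned e h𝔪 h𝔠 hle hψ₀ heq hsharp θ hθ w (hwp w hw)
  have hTv : ∀ w, w ∈ Tℓ ↔ w.under (𝓞 ℚ) = v ∧ ¬ 𝔠 ≤ w.asIdeal := fun w ↦ by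
    rw [hT, hover]
    constructor
    · rintro ⟨hw, hunr⟩; exact ⟨hw, (havatar w hw).1.mp hunr⟩
    · rintro ⟨hw, hnle⟩; exact ⟨hw, (havatar w hw).1.mpr hnle⟩
  have hval : ∀ w ∈ Tℓ, ((((θ (φ w) : GL (Fin 1) (padicCoeffIntegers S)) : Matrix (Fin 1) (Fin 1) (padicCoeffIntegers S)) 0 0 :
      padicCoeffIntegers S) : PadicAlgCl p) = e.symm (ψ₀ w) := fun w hw ↦ by
    obtain ⟨hwv', hnle⟩ := (hTv w).mp hw
    obtain ⟨𝔓, h𝔓, hF⟩ := hφ w hw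
    exact (havatar w hwv').2 hnle 𝔓 h𝔓 (φ w) hF
  -- the coefficient `ι a_ℓ(g)` is the theta coefficient of the primitive pair
  have hcoefℓ : embCoeff g ι (natGenerator v) =
      e.symm (∑ᶠ J ∈ {J : Ideal (𝓞 K) | Ideal.absNorm J = natGenerator v}, rayClassCoeff 𝔠 ψ₀ J) :=
    hcoef _ (prime_natGenerator v).pos
  -- the Kronecker character and `ψ₀((ℓ)) = κ(ℓ)·ℓ` for `ℓ` prime to `|d_K|·N𝔠`
  obtain ⟨κ, -, -, -, hκJ, hζ⟩ := exists_kroneckerChar_odd_jacobiSym_dedekindZeta (K := K) hK2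
  have hψ₀G : IsGrossencharakter 𝔠 (fun w => (((2 : ℕ) : ℤ) - 1) * embType σK w) (fun w => (((2 : ℕ) : ℤ) - 1) * embTypeConj σK w) ψ₀ := by
    convert hψ₀ using 2 <;> norm_num
  have hψ₀ℓ : (natGenerator v).Coprime ((discr K).natAbs * Ideal.absNorm 𝔠) →
      idealPow K ψ₀ (Ideal.span {((natGenerator v : ℕ) : 𝓞 K)}) = κ (natGenerator v) * (natGenerator v : ℂ) := fun hcop ↦ by
    rw [idealPow_span_natCast_eq_kroneckerChar_mul_pow hK2 σK (k := 2) (by norm_num) hκJ hψ₀G hneb₀ hcop, pow_one]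
  -- `κ(ℓ) = ±1` forces `ℓ ∤ d_K`
  have hD0 : (discr K).natAbs ≠ 0 := Int.natAbs_ne_zero.mpr (NumberField.discr_ne_zero K)
  have hcopD : κ (natGenerator v) ≠ 0 → ¬ natGenerator v ∣ (discr K).natAbs := fun hκ hdvd ↦ by
    apply hκ
    refine MulChar.map_nonunit κ fun hu ↦ ?_
    have hcop := (ZMod.isUnit_iff_coprime _ _).mp hu
    exact (Nat.Prime.coprime_iff_not_dvd (prime_natGenerator v)).mp hcop hdvd
  -- `ℓ ∣ N𝔠 ↔` some prime of `𝔠` over `ℓ`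
  have hdvd𝔠 := dvd_absNorm_iff_exists_le (K := K) v h𝔠
  have hsetunder : ∀ {A : Set (HeightOneSpectrum (𝓞 K))}, {w : HeightOneSpectrum (𝓞 K) | w.under (𝓞 ℚ) = v} = A →
      {w : HeightOneSpectrum (𝓞 K) | w.asIdeal.under (𝓞 ℚ) = v.asIdeal} = A := fun {A} hS ↦ by
    rw [← hS]; ext w; simp only [Set.mem_setOf_eq, HeightOneSpectrum.ext_iff, HeightOneSpectrum.under_asIdeal]
  -- the decomposition of `ℓ` in `K`
  rcases placesOver_trichotomy_of_finrank_eq_two K hK2 v with ⟨w₁, w₂, hne, hS, hall⟩ | ⟨w₀, hS, -, hf2⟩ | ⟨w₀, hS, he2, hf1⟩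
  · -- SPLIT: `ℓ = w₁ w₂`
    have hS' := hsetunder hS
    have hw₁ : w₁.under (𝓞 ℚ) = v := by have : w₁ ∈ ({w₁, w₂} : Set _) := Set.mem_insert _ _; rw [← hS] at this; exact this
    have hw₂ : w₂.under (𝓞 ℚ) = v := by have : w₂ ∈ ({w₁, w₂} : Set _) := Set.mem_insert_of_mem _ rfl; rw [← hS] at this; exact this
    have hmem : ∀ w, w.under (𝓞 ℚ) = v → w = w₁ ∨ w = w₂ := fun w hw ↦ by
      have : w ∈ ({w₁, w₂} : Set _) := by rw [← hS]; exact hw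
      simpa using this
    have hκ1 : κ (natGenerator v) = 1 := kroneckerChar_natGenerator_eq_one_of_pair hζ v hne hS' (hall w₁ hw₁).2 (hall w₂ hw₂).2
    have hℓd : ¬ natGenerator v ∣ (discr K).natAbs := hcopD (by rw [hκ1]; exact one_ne_zero)
    -- the theta coefficient
    have hsum : (∑ᶠ J ∈ {J : Ideal (𝓞 K) | Ideal.absNorm J = natGenerator v}, rayClassCoeff 𝔠 ψ₀ J) =
        rayClassCoeff 𝔠 ψ₀ w₁.asIdeal + rayClassCoeff 𝔠 ψ₀ w₂.asIdeal :=
      finsum_mem_setOf_absNorm_eq_of_pair v hne hS' (hall w₁ hw₁).2 (hall w₂ hw₂).2 _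
    -- `ℓ ∣ M ↔ (𝔠 ≤ w₁ ∨ 𝔠 ≤ w₂)`
    have hdvdM : natGenerator v ∣ (discr K).natAbs * Ideal.absNorm 𝔠 ↔ (𝔠 ≤ w₁.asIdeal ∨ 𝔠 ≤ w₂.asIdeal) := by
      rw [Nat.Prime.dvd_mul (prime_natGenerator v), or_iff_right hℓd, hdvd𝔠]
      constructor
      · rintro ⟨w, hw, hwle⟩
        rcases hmem w hw with rfl | rfl
        · exact Or.inl hwle
        · exact Or.inr hwle
      · rintro (h | h)
        · exact ⟨w₁, hw₁, h⟩
        · exact ⟨w₂, hw₂, h⟩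
    by_cases h₁ : 𝔠 ≤ w₁.asIdeal <;> by_cases h₂ : 𝔠 ≤ w₂.asIdeal
    · -- both primes of `𝔠`: `Tℓ = ∅`, `a_ℓ = 0`, `ℓ ∣ M`
      have hTe : Tℓ = ∅ := by
        ext w; simp only [Finset.notMem_empty, iff_false, hTv]
        rintro ⟨hw, hnle⟩
        rcases hmem w hw with rfl | rfl
        · exact hnle h₁
        · exact hnle h₂
      rw [hcoefℓ, hsum, rayClassCoeff_asIdeal_of_le _ _ h₁, rayClassCoeff_asIdeal_of_le _ _ h₂, add_zero, map_zero,
        if_pos (hdvdM.mpr (Or.inl h₁)), hTe, Finset.prod_empty]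
      simp
    · -- `w₁ ∣ 𝔠`, `w₂ ∤ 𝔠`: `Tℓ = {w₂}`
      have hTe : Tℓ = {w₂} := by
        ext w; simp only [Finset.mem_singleton, hTv]
        constructor
        · rintro ⟨hw, hnle⟩
          rcases hmem w hw with rfl | rfl
          · exact absurd h₁ hnle
          · rfl
        · rintro rfl; exact ⟨hw₂, h₂⟩
      have hT₂ : w₂ ∈ Tℓ := by rw [hTe]; exact Finset.mem_singleton_self _
      have hf₂ : f w₂ = 1 := (eq_inertiaDeg_of_residueCard_eq hw₂ (hf w₂ hT₂)).trans (hall w₂ hw₂).2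
      rw [hcoefℓ, hsum, rayClassCoeff_asIdeal_of_le _ _ h₁, rayClassCoeff_asIdeal_of_not_le _ _ h₂, zero_add,
        if_pos (hdvdM.mpr (Or.inl h₁)), hTe, Finset.prod_singleton, hval w₂ hT₂, hf₂]
      simp
    · -- `w₁ ∤ 𝔠`, `w₂ ∣ 𝔠`: `Tℓ = {w₁}`
      have hTe : Tℓ = {w₁} := by
        ext w; simp only [Finset.mem_singleton, hTv]
        constructor
        · rintro ⟨hw, hnle⟩
          rcases hmem w hw with rfl | rfl
          · rfl
          · exact absurd h₂ hnle
        · rintro rfl; exact ⟨hw₁, h₁⟩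
      have hT₁ : w₁ ∈ Tℓ := by rw [hTe]; exact Finset.mem_singleton_self _
      have hf₁ : f w₁ = 1 := (eq_inertiaDeg_of_residueCard_eq hw₁ (hf w₁ hT₁)).trans (hall w₁ hw₁).2
      rw [hcoefℓ, hsum, rayClassCoeff_asIdeal_of_not_le _ _ h₁, rayClassCoeff_asIdeal_of_le _ _ h₂, add_zero,
        if_pos (hdvdM.mpr (Or.inr h₂)), hTe, Finset.prod_singleton, hval w₁ hT₁, hf₁]
      simp
    · -- both prime to `𝔠`: `Tℓ = {w₁, w₂}`, `ℓ ∤ M`, `ψ₀(w₁)ψ₀(w₂) = ℓ`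
      have hTe : Tℓ = {w₁, w₂} := by
        ext w; simp only [Finset.mem_insert, Finset.mem_singleton, hTv]
        constructor
        · rintro ⟨hw, -⟩; exact hmem w hw
        · rintro (rfl | rfl)
          · exact ⟨hw₁, h₁⟩
          · exact ⟨hw₂, h₂⟩
      have hT₁ : w₁ ∈ Tℓ := by rw [hTe]; exact Finset.mem_insert_self _ _
      have hT₂ : w₂ ∈ Tℓ := by rw [hTe]; exact Finset.mem_insert_of_mem (Finset.mem_singleton_self _)
      have hf₁ : f w₁ = 1 := (eq_inertiaDeg_of_residueCard_eq hw₁ (hf w₁ hT₁)).trans (hall w₁ hw₁).2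
      have hf₂ : f w₂ = 1 := (eq_inertiaDeg_of_residueCard_eq hw₂ (hf w₂ hT₂)).trans (hall w₂ hw₂).2
      have hndM : ¬ natGenerator v ∣ (discr K).natAbs * Ideal.absNorm 𝔠 := fun h ↦ by
        rcases hdvdM.mp h with h | h
        · exact h₁ h
        · exact h₂ h
      have hcop : (natGenerator v).Coprime ((discr K).natAbs * Ideal.absNorm 𝔠) :=
        (Nat.Prime.coprime_iff_not_dvd (prime_natGenerator v)).mpr hndM
      have hprod : ψ₀ w₁ * ψ₀ w₂ = (natGenerator v : ℂ) := by
        rw [← idealPow_span_natGenerator_of_pair hK2 ψ₀ v hne hS' (hall w₁ hw₁).2 (hall w₂ hw₂).2, hψ₀ℓ hcop, hκ1, one_mul]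
      have hℓe : ((natGenerator v : ℕ) : PadicAlgCl p) = e.symm (ψ₀ w₁) * e.symm (ψ₀ w₂) := by rw [← map_mul, hprod, map_natCast]
      rw [hcoefℓ, hsum, rayClassCoeff_asIdeal_of_not_le _ _ h₁, rayClassCoeff_asIdeal_of_not_le _ _ h₂, if_neg hndM, hTe,
        Finset.prod_pair hne, hval w₁ hT₁, hval w₂ hT₂, hf₁, hf₂, hℓe]
      simp only [map_add, map_mul]
      ring
  · -- INERT: `(ℓ) = w₀`, no ideal of norm `ℓ`
    have hS' := hsetunder hS
    have hw₀ : w₀.under (𝓞 ℚ) = v := by have : w₀ ∈ ({w₀} : Set _) := Set.mem_singleton _; rw [← hS] at this; exact this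
    have hmem : ∀ w, w.under (𝓞 ℚ) = v → w = w₀ := fun w hw ↦ by
      have : w ∈ ({w₀} : Set _) := by rw [← hS]; exact hw
      simpa using this
    have hκ1 : κ (natGenerator v) = -1 := kroneckerChar_natGenerator_eq_neg_one_of_singleton hζ v hS' hf2
    have hℓd : ¬ natGenerator v ∣ (discr K).natAbs := hcopD (by rw [hκ1]; norm_num)
    have hsum : (∑ᶠ J ∈ {J : Ideal (𝓞 K) | Ideal.absNorm J = natGenerator v}, rayClassCoeff 𝔠 ψ₀ J) = 0 :=
      finsum_mem_setOf_absNorm_eq_of_singleton v hS' hf2 _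
    have hdvdM : natGenerator v ∣ (discr K).natAbs * Ideal.absNorm 𝔠 ↔ 𝔠 ≤ w₀.asIdeal := by
      rw [Nat.Prime.dvd_mul (prime_natGenerator v), or_iff_right hℓd, hdvd𝔠]
      constructor
      · rintro ⟨w, hw, hwle⟩; rw [← hmem w hw]; exact hwle
      · intro h; exact ⟨w₀, hw₀, h⟩
    by_cases h₀ : 𝔠 ≤ w₀.asIdeal
    · -- `w₀ ∣ 𝔠`: `Tℓ = ∅`
      have hTe : Tℓ = ∅ := by
        ext w; simp only [Finset.notMem_empty, iff_false, hTv]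
        rintro ⟨hw, hnle⟩
        rw [hmem w hw] at hnle
        exact hnle h₀
      rw [hcoefℓ, hsum, map_zero, if_pos (hdvdM.mpr h₀), hTe, Finset.prod_empty]
      simp
    · -- `w₀ ∤ 𝔠`: `Tℓ = {w₀}`, `f = 2`, `ψ₀(w₀) = −ℓ`
      have hTe : Tℓ = {w₀} := by
        ext w; simp only [Finset.mem_singleton, hTv]
        constructor
        · rintro ⟨hw, -⟩; exact hmem w hw
        · rintro rfl; exact ⟨hw₀, h₀⟩
      have hT₀ : w₀ ∈ Tℓ := by rw [hTe]; exact Finset.mem_singleton_self _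
      have hf₀ : f w₀ = 2 := (eq_inertiaDeg_of_residueCard_eq hw₀ (hf w₀ hT₀)).trans hf2
      have hndM : ¬ natGenerator v ∣ (discr K).natAbs * Ideal.absNorm 𝔠 := fun h ↦ h₀ (hdvdM.mp h)
      have hcop : (natGenerator v).Coprime ((discr K).natAbs * Ideal.absNorm 𝔠) :=
        (Nat.Prime.coprime_iff_not_dvd (prime_natGenerator v)).mpr hndM
      have hψw₀ : ψ₀ w₀ = -(natGenerator v : ℂ) := by
        rw [← idealPow_span_natGenerator_of_singleton hK2 ψ₀ v hS' hf2, hψ₀ℓ hcop, hκ1, neg_one_mul]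
      have hval₀ : ((((θ (φ w₀) : GL (Fin 1) (padicCoeffIntegers S)) : Matrix (Fin 1) (Fin 1) (padicCoeffIntegers S)) 0 0 :
          padicCoeffIntegers S) : PadicAlgCl p) = -((natGenerator v : ℕ) : PadicAlgCl p) := by
        rw [hval w₀ hT₀, hψw₀, map_neg, map_natCast]
      rw [hcoefℓ, hsum, map_zero, if_neg hndM, hTe, Finset.prod_singleton, hval₀, hf₀]
      simp [map_neg]
  · -- RAMIFIED: `(ℓ) = w₀²`, `ℓ ∣ d_K ∣ M`
    have hw₀ : w₀.under (𝓞 ℚ) = v := by have : w₀ ∈ ({w₀} : Set _) := Set.mem_singleton _; rw [← hS] at this; exact this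
    have hmem : ∀ w, w.under (𝓞 ℚ) = v → w = w₀ := fun w hw ↦ by
      have : w ∈ ({w₀} : Set _) := by rw [← hS]; exact hw
      simpa using this
    have hℓd : natGenerator v ∣ (discr K).natAbs := by
      have h := natGenerator_dvd_discr_of_ramificationIdx_eq_two K w₀ he2
      rw [hw₀] at h
      exact Int.ofNat_dvd_left.mp h
    have hdvdM : natGenerator v ∣ (discr K).natAbs * Ideal.absNorm 𝔠 := hℓd.mul_right _
    have hsum : (∑ᶠ J ∈ {J : Ideal (𝓞 K) | Ideal.absNorm J = natGenerator v}, rayClassCoeff 𝔠 ψ₀ J) = rayClassCoeff 𝔠 ψ₀ w₀.asIdeal := by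
      rw [setOf_absNorm_eq_of_ramified v hS hf1, finsum_mem_singleton]
    by_cases h₀ : 𝔠 ≤ w₀.asIdeal
    · have hTe : Tℓ = ∅ := by
        ext w; simp only [Finset.notMem_empty, iff_false, hTv]
        rintro ⟨hw, hnle⟩
        rw [hmem w hw] at hnle
        exact hnle h₀
      rw [hcoefℓ, hsum, rayClassCoeff_asIdeal_of_le _ _ h₀, map_zero, if_pos hdvdM, hTe, Finset.prod_empty]
      simp
    · have hTe : Tℓ = {w₀} := by
        ext w; simp only [Finset.mem_singleton, hTv]
        constructor
        · rintro ⟨hw, -⟩; exact hmem w hw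
        · rintro rfl; exact ⟨hw₀, h₀⟩
      have hT₀ : w₀ ∈ Tℓ := by rw [hTe]; exact Finset.mem_singleton_self _
      have hf₀ : f w₀ = 1 := (eq_inertiaDeg_of_residueCard_eq hw₀ (hf w₀ hT₀)).trans hf1
      rw [hcoefℓ, hsum, rayClassCoeff_asIdeal_of_not_le _ _ h₀, if_pos hdvdM, hTe, Finset.prod_singleton, hval w₀ hT₀, hf₀]
      simp

end Main

end Summit.BirchSwinnertonDyer.BirchSwinnertonDyer.Theorems.RibetBadEulerFactor

end
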